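import Literature.Analysis.ValidatedNumerics.ExpPoly.Poly

/-!
# Exact exp-polynomial algebra over `ℚ`, II: block sums `Σ p(x) e^{κx+θ}`, formal sums `Σ c e^q`, canonical forms

Continues `ExpPoly/Poly.lean`.  A BLOCK is `p(x) · e^{κx+θ}` with `κ, θ ∈ ℚ` and `p : Poly` (`Blk`);
an exp-polynomial is a finite sum of blocks (`EP := List Blk`) with denotation `EP.eval L : ℝ → ℝ`;
the file provides scalar multiples, the product `EP.mul` (rates and phases add, polynomial factors
multiply), collection of equal keys `(κ, θ)` (`EP.ins`, `EP.merge`) and the CANONICAL FORM `EP.canon`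
(sorted by `(κ, θ)`, equal keys collected, trailing zero coefficients removed, empty blocks dropped),
whose purpose is `EP.eval_eq_of_canon_eq`: a kernel-decided syntactic equation `canon L = M` yields
`eval L = eval M`.  FORMAL SUMS `Σ c · e^q` (`FS := List (ℚ × ℚ)`, value `FS.eval : ℝ`) are the shape
of exact definite integrals, with normal form `FS.norm` and `FS.eval_eq_of_norm_eq`; ONE-VARIABLE
EXPONENTIAL SUMS `Σ a e^{κt}` (`ES`) are the convolution factors of `ExpPoly/Calculus.lean`.
Constructors `mkEP`, `mkFS` read raw integer data.  All data-level functions are computable and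
structurally recursive (kernel reduction by `decide`); every operation comes with its
soundness theorem over `ℝ`.

Origin: lines 260–447, 493–526, 618–701, 808–814 of the package file `Dhl42/ClosedForm/ExpPoly.lean`
of the DHL[42,2] certificate (see `ExpPoly/Poly.lean`); declarations unchanged but for the namespace;
no number theory is stated.

## Main definitions (namespace `Literature.Analysis.ValidatedNumerics.ExpPoly`)

* `Blk` (fields `κ θ : ℚ`, `p : Poly`), `Blk.eval`; `EP := List Blk`, `EP.eval`, `EP.smul`, `EP.mul`,
  `EP.ins`, `EP.merge`, `EP.insC`, `EP.canon`.
* `FS := List (ℚ × ℚ)`, `FS.eval`, `FS.smul`, `FS.ins`, `FS.norm`.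
* `ES := List (ℚ × ℚ)`, `ES.eval f t = Σ a e^{κt}`, `ES.toEP`.
* `mkEP`, `mkFS`.

## Main results

* `EP.eval_mul : eval (mul L M) x = eval L x * eval M x`; `EP.eval_merge`, `EP.eval_canon`,
  `EP.eval_eq_of_canon_eq : canon L = M → eval L = eval M`.
* `FS.eval_norm`, `FS.eval_eq_of_norm_eq : norm A = norm B → eval A = eval B`.
* `ES.eval_toEP`; continuity of all denotations.

NOT here: integrals and convolutions (`ExpPoly/Calculus.lean`); uniqueness of canonical forms (only
soundness is needed: a failed syntactic check proves nothing).

## References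

* The group ring `ℚ[x][e^{ℚx}]` handled by lists with explicit normal forms; `e^{s+t} = e^s e^t`.
  [folklore]
-/

open Real

namespace Literature.Analysis.ValidatedNumerics.ExpPoly

/-! ## Blocks `p(x) e^{κx+θ}` and finite sums of blocks -/

/-- A block `p(x) · e^{κ x + θ}`. [folklore] -/
structure Blk where
  /-- rate -/
  κ : ℚ
  /-- phase -/
  θ : ℚ
  /-- polynomial factor -/
  p : Poly
  deriving DecidableEq, Repr

namespace Blk

/-- The real function `x ↦ p(x) e^{κx+θ}`. [folklore] -/
noncomputable def eval (b : Blk) (x : ℝ) : ℝ := Poly.eval b.p x * exp ((b.κ : ℝ) * x + b.θ)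

/-- A block `x ↦ p(x) e^{κx+θ}` is a continuous function. [folklore] -/
theorem continuous_eval (b : Blk) : Continuous b.eval := by
  unfold eval
  exact (Poly.continuous_eval b.p).mul (continuous_exp.comp (by fun_prop))

end Blk

/-- Finite sums of blocks. [folklore] -/
abbrev EP := List Blk

namespace EP

/-- The real function `x ↦ Σ_b p_b(x) e^{κ_b x + θ_b}`. [folklore] -/
noncomputable def eval : EP → ℝ → ℝ
  | [], _ => 0
  | b :: L, x => b.eval x + eval L x

/-- The empty block sum is the zero function. [folklore] -/
@[simp] theorem eval_nil (x : ℝ) : EP.eval [] x = 0 := rfl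
/-- `eval (b :: L) x = b.eval x + eval L x`. [folklore] -/
@[simp] theorem eval_cons (b : Blk) (L : EP) (x : ℝ) : eval (b :: L) x = b.eval x + eval L x := rfl

/-- `eval` is additive under concatenation of block lists. [folklore] -/
theorem eval_append : ∀ (L M : EP) (x : ℝ), eval (L ++ M) x = eval L x + eval M x
  | [], M, x => by simp
  | b :: L, M, x => by simp [eval_append L M x, add_assoc]

/-- A block sum is a continuous function. [folklore] -/
theorem continuous_eval : ∀ (L : EP), Continuous (eval L)
  | [] => by
      show Continuous (fun _ : ℝ => (0 : ℝ)); exact continuous_const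
  | b :: L => by
      show Continuous (fun x => b.eval x + eval L x)
      exact b.continuous_eval.add (continuous_eval L)

/-- `eval` of a `flatMap` is the sum of the `eval`s (used for products and convolutions, which are
built blockwise). [folklore] -/
theorem eval_flatMap {α : Type*} (f : List α) (G : α → EP) (x : ℝ) :
    eval (f.flatMap G) x = (f.map fun a => eval (G a) x).sum := by
  induction f with
  | nil => simp
  | cons a f ih => simp [List.flatMap_cons, eval_append, ih]

/-- Scalar multiple. [folklore] -/
def smul (c : ℚ) (L : EP) : EP := L.map fun b => ⟨b.κ, b.θ, Poly.smul c b.p⟩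

/-- Soundness of `smul`: `eval (smul c L) x = c · eval L x`. [folklore] -/
theorem eval_smul (c : ℚ) : ∀ (L : EP) (x : ℝ), eval (smul c L) x = c * eval L x
  | [], x => by simp [smul]
  | b :: L, x => by
      have ih := eval_smul c L x
      simp only [smul, List.map_cons, eval_cons] at ih ⊢
      rw [ih]; simp [Blk.eval, Poly.eval_smul]; ring

/-- Product of two block sums. [folklore] -/
def mul (L M : EP) : EP :=
  L.flatMap fun b => M.map fun c => ⟨b.κ + c.κ, b.θ + c.θ, Poly.mul b.p c.p⟩

/-- One block times a block sum: multiplying `b` into every block of `M` (rates and phases add,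
polynomial factors multiply) evaluates to `b.eval x · eval M x` (`e^{s+t} = e^s e^t`). [folklore] -/
theorem eval_mul_one (b : Blk) : ∀ (M : EP) (x : ℝ),
    eval (M.map fun c => (⟨b.κ + c.κ, b.θ + c.θ, Poly.mul b.p c.p⟩ : Blk)) x = b.eval x * eval M x
  | [], x => by simp
  | c :: M, x => by
      rw [List.map_cons, eval_cons, eval_mul_one b M x, eval_cons, mul_add]
      congr 1
      simp only [Blk.eval, Poly.eval_mul]
      push_cast
      rw [show ((b.κ : ℝ) + c.κ) * x + (b.θ + c.θ) = ((b.κ : ℝ) * x + b.θ) + ((c.κ : ℝ) * x + c.θ) by ring,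
        exp_add]
      ring

/-- Soundness of the product: `eval (mul L M) x = eval L x · eval M x`. [folklore] -/
theorem eval_mul : ∀ (L M : EP) (x : ℝ), eval (mul L M) x = eval L x * eval M x
  | [], M, x => by simp [mul]
  | b :: L, M, x => by
      have ih := eval_mul L M x
      simp only [mul, List.flatMap_cons] at ih ⊢
      rw [eval_append, eval_mul_one, ih, eval_cons]; ring

/-- Insert a block, adding polynomial factors when `(κ, θ)` agree. [folklore] -/
def ins (b : Blk) : EP → EP
  | [] => [b]
  | c :: L => if b.κ = c.κ ∧ b.θ = c.θ then ⟨c.κ, c.θ, Poly.add b.p c.p⟩ :: L else c :: ins b L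

/-- Soundness of `ins`: inserting a block (collecting an equal key `(κ, θ)` if present) adds its
value. [folklore] -/
theorem eval_ins (b : Blk) : ∀ (L : EP) (x : ℝ), eval (ins b L) x = b.eval x + eval L x
  | [], x => by simp [ins]
  | c :: L, x => by
      unfold ins
      split_ifs with h
      · obtain ⟨hκ, hθ⟩ := h
        simp only [eval_cons, Blk.eval, Poly.eval_add, hκ, hθ]
        ring
      · rw [eval_cons, eval_cons, eval_ins b L x]; ring

/-- Collect blocks with equal `(κ, θ)`. [folklore] -/
def merge (L : EP) : EP := L.foldr ins []

/-- Soundness of `merge`: collecting equal keys does not change the denotation. [folklore] -/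
theorem eval_merge : ∀ (L : EP) (x : ℝ), eval (merge L) x = eval L x
  | [], x => by simp [merge]
  | b :: L, x => by
      have ih := eval_merge L x
      simp only [merge, List.foldr_cons] at ih ⊢
      rw [eval_ins, ih, eval_cons]

end EP

/-! ## Formal finite sums `Σ c e^{q}` -/

/-- Formal sums `Σ c · e^{q}`: lists of `(q, c)`. [folklore] -/
abbrev FS := List (ℚ × ℚ)

namespace FS

/-- The real value `Σ c · e^{q}`. [folklore] -/
noncomputable def eval : FS → ℝ
  | [] => 0
  | qc :: L => (qc.2 : ℝ) * exp (qc.1 : ℝ) + eval L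

/-- The empty formal sum has value `0`. [folklore] -/
@[simp] theorem eval_nil : eval [] = 0 := rfl
/-- `eval ((q, c) :: L) = c · e^q + eval L`. [folklore] -/
@[simp] theorem eval_cons (qc : ℚ × ℚ) (L : FS) : eval (qc :: L) = (qc.2 : ℝ) * exp (qc.1 : ℝ) + eval L := rfl

/-- `eval` is additive under concatenation. [folklore] -/
theorem eval_append : ∀ (L M : FS), eval (L ++ M) = eval L + eval M
  | [], M => by simp
  | qc :: L, M => by simp [eval_append L M, add_assoc]

/-- `eval` of a `flatMap` is the sum of the `eval`s. [folklore] -/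
theorem eval_flatMap {α : Type*} (f : List α) (G : α → FS) :
    eval (f.flatMap G) = (f.map fun a => eval (G a)).sum := by
  induction f with
  | nil => simp
  | cons a f ih => simp [List.flatMap_cons, eval_append, ih]

/-- Scalar multiple. [folklore] -/
def smul (c : ℚ) (L : FS) : FS := L.map fun qc => (qc.1, c * qc.2)

/-- Soundness of `smul`: `eval (smul c L) = c · eval L`. [folklore] -/
theorem eval_smul (c : ℚ) : ∀ (L : FS), eval (smul c L) = c * eval L
  | [] => by simp [smul]
  | qc :: L => by
      have ih := eval_smul c L
      simp only [smul, List.map_cons, eval_cons] at ih ⊢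
      rw [ih]; push_cast; ring

/-- Sorted insertion, adding coefficients of equal exponents. [folklore] -/
def ins (qc : ℚ × ℚ) : FS → FS
  | [] => [qc]
  | rd :: L =>
      if qc.1 = rd.1 then (rd.1, qc.2 + rd.2) :: L
      else if qc.1 < rd.1 then qc :: rd :: L
      else rd :: ins qc L

/-- Soundness of the sorted insertion `ins`: it adds the value `c · e^q` of the inserted pair
(whether or not an equal exponent is collected). [folklore] -/
theorem eval_ins (qc : ℚ × ℚ) : ∀ (L : FS), eval (ins qc L) = (qc.2 : ℝ) * exp (qc.1 : ℝ) + eval L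
  | [] => by simp [ins]
  | rd :: L => by
      unfold ins
      split_ifs with h1 h2
      · simp only [eval_cons, h1]; push_cast; ring
      · simp
      · rw [eval_cons, eval_cons, eval_ins qc L]; ring

/-- Normal form: sorted by exponent, equal exponents collected, zero coefficients dropped.
[folklore] -/
def norm (L : FS) : FS := (L.foldr ins []).filter fun qc => decide (qc.2 ≠ 0)

/-- Dropping pairs with zero coefficient does not change the value. [folklore] -/
theorem eval_filter_ne_zero : ∀ (L : FS), eval (L.filter fun qc => decide (qc.2 ≠ 0)) = eval L
  | [] => by simp
  | qc :: L => by
      rw [List.filter_cons]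
      split_ifs with h
      · rw [eval_cons, eval_cons, eval_filter_ne_zero L]
      · have h0 : qc.2 = 0 := by simpa using h
        rw [eval_cons, eval_filter_ne_zero L, h0]; simp

/-- Soundness of the normal form: `eval (norm L) = eval L`. [folklore] -/
theorem eval_norm (L : FS) : eval (norm L) = eval L := by
  unfold norm
  rw [eval_filter_ne_zero]
  induction L with
  | nil => simp
  | cons qc L ih => simp only [List.foldr_cons, eval_ins, ih, eval_cons]

/-- Two formal sums with the same normal form have the same real value — the form in which the
kernel's checkpoint equations `norm A = norm B` (decided by `decide`) are consumed. [folklore] -/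
theorem eval_eq_of_norm_eq {A B : FS} (h : norm A = norm B) : eval A = eval B := by
  rw [← eval_norm A, ← eval_norm B, h]

end FS

/-! ## One-variable exponential sums `Σ a e^{κ t}` -/

/-- One-variable exponential sums `Σ a e^{κ t}`: lists of `(κ, a)`. [folklore] -/
abbrev ES := List (ℚ × ℚ)

namespace ES

/-- The real function `t ↦ Σ a e^{κ t}`. [folklore] -/
noncomputable def eval : ES → ℝ → ℝ
  | [], _ => 0
  | ka :: f, t => (ka.2 : ℝ) * exp ((ka.1 : ℝ) * t) + eval f t

/-- The empty exponential sum is the zero function. [folklore] -/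
@[simp] theorem eval_nil (t : ℝ) : ES.eval [] t = 0 := rfl
/-- `eval ((κ, a) :: f) t = a · e^{κt} + eval f t`. [folklore] -/
@[simp] theorem eval_cons (ka : ℚ × ℚ) (f : ES) (t : ℝ) :
    eval (ka :: f) t = (ka.2 : ℝ) * exp ((ka.1 : ℝ) * t) + eval f t := rfl

/-- A one-variable exponential sum is a continuous function. [folklore] -/
theorem continuous_eval : ∀ (f : ES), Continuous (eval f)
  | [] => by
      show Continuous (fun _ : ℝ => (0 : ℝ)); exact continuous_const
  | ka :: f => by
      show Continuous (fun t => (ka.2 : ℝ) * exp ((ka.1 : ℝ) * t) + eval f t)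
      exact (continuous_const.mul (continuous_exp.comp (by fun_prop))).add (continuous_eval f)

/-- As a block sum (all polynomial factors constant, phase `0`). [folklore] -/
def toEP (f : ES) : EP := f.map fun ka => ⟨ka.1, 0, [ka.2]⟩

/-- Soundness of `toEP`: the block-sum form of `f` has the same denotation,
`EP.eval (toEP f) t = eval f t`. [folklore] -/
theorem eval_toEP : ∀ (f : ES) (t : ℝ), EP.eval (toEP f) t = eval f t
  | [], t => by simp [toEP]
  | ka :: f, t => by
      have ih := eval_toEP f t
      simp only [toEP, List.map_cons, EP.eval_cons, eval_cons] at ih ⊢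
      rw [ih]; simp [Blk.eval]

end ES

/-! ## Canonical form of a block sum (sorted by `(κ, θ)`, equal keys collected, trailing zero
coefficients removed, empty blocks dropped) — used to state the kernel's checkpoint equations. -/

namespace EP

/-- Sorted insertion by `(κ, θ)`, collecting equal keys. [folklore] -/
def insC (b : Blk) : EP → EP
  | [] => [b]
  | c :: L =>
      if b.κ = c.κ ∧ b.θ = c.θ then ⟨c.κ, c.θ, Poly.add b.p c.p⟩ :: L
      else if b.κ < c.κ ∨ (b.κ = c.κ ∧ b.θ < c.θ) then b :: c :: L
      else c :: insC b L

/-- Soundness of the sorted insertion `insC`: it adds the value of the inserted block. [folklore] -/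
theorem eval_insC (b : Blk) : ∀ (L : EP) (x : ℝ), eval (insC b L) x = b.eval x + eval L x
  | [], x => by simp [insC]
  | c :: L, x => by
      unfold insC
      split_ifs with h h'
      · obtain ⟨hκ, hθ⟩ := h
        simp only [eval_cons, Blk.eval, Poly.eval_add, hκ, hθ]
        ring
      · simp
      · rw [eval_cons, eval_cons, eval_insC b L x]; ring

/-- Canonical form. [folklore] -/
def canon (L : EP) : EP :=
  ((L.foldr insC []).map fun b => (⟨b.κ, b.θ, Poly.trim b.p⟩ : Blk)).filter fun b => !b.p.isEmpty

/-- Trimming every polynomial factor does not change the denotation of a block sum. [folklore] -/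
theorem eval_map_trim : ∀ (L : EP) (x : ℝ),
    eval (L.map fun b => (⟨b.κ, b.θ, Poly.trim b.p⟩ : Blk)) x = eval L x
  | [], x => rfl
  | b :: L, x => by
      rw [List.map_cons, eval_cons, eval_cons, eval_map_trim L x]
      simp [Blk.eval, Poly.eval_trim]

/-- Dropping blocks with empty polynomial factor (value `0`) does not change the denotation.
[folklore] -/
theorem eval_filter_nonempty : ∀ (L : EP) (x : ℝ),
    eval (L.filter fun b => !b.p.isEmpty) x = eval L x
  | [], x => rfl
  | b :: L, x => by
      rw [List.filter_cons]
      split_ifs with h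
      · rw [eval_cons, eval_cons, eval_filter_nonempty L x]
      · have hp : b.p = [] := by
          cases hq : b.p with
          | nil => rfl
          | cons c q => simp [hq] at h
        rw [eval_cons, eval_filter_nonempty L x]
        simp [Blk.eval, hp]

/-- Soundness of the canonical form: `eval (canon L) = eval L` pointwise. [folklore] -/
theorem eval_canon (L : EP) (x : ℝ) : eval (canon L) x = eval L x := by
  unfold canon
  rw [eval_filter_nonempty, eval_map_trim]
  induction L with
  | nil => rfl
  | cons b L ih => simp only [List.foldr_cons, eval_insC, ih, eval_cons]

/-- If the canonical form of `L` is (syntactically) `M`, then `L` and `M` denote the same function —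
the form in which kernel-decided checkpoint equations `canon L = M` are consumed. [folklore] -/
theorem eval_eq_of_canon_eq {L M : EP} (h : canon L = M) : eval L = eval M := by
  funext x; rw [← h, eval_canon]

end EP

/-! ## Raw integer data -/

/-- A block sum from raw data `(κ, θ, coefficients)`; rates and phases as `(num, den)`.
[folklore] -/
def mkEP (L : List ((ℤ × ℕ) × (ℤ × ℕ) × List (ℤ × ℕ))) : EP :=
  L.map fun d => ⟨mkRat d.1.1 d.1.2, mkRat d.2.1.1 d.2.1.2, mkPoly d.2.2⟩

/-- A formal sum from raw data `((q_num, q_den), (c_num, c_den))`. [folklore] -/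
def mkFS (L : List ((ℤ × ℕ) × (ℤ × ℕ))) : FS :=
  L.map fun d => (mkRat d.1.1 d.1.2, mkRat d.2.1 d.2.2)

end Literature.Analysis.ValidatedNumerics.ExpPoly
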